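import Summits.FinalStateConjecture.FinalStateConjecture.Theorems.EIHFluxBalanceInertialRecessionStubHigherOrderVariationPrep

/-!
# Route EIHFluxBalance — `InertialRecession` (E′), line `SketchCleanExcision`, skeleton r13,
# stub `stub_higherOrderSlaving` (EF): the lab-time variations of one painted summand — structure
# and bounds to order three

Helper file for the crux `stmt-FinalStateConjecture-17403`
(`Summit.FinalStateConjecture.FinalStateConjecture.Theses.EIHFluxBalance.InertialRecession`, E′),
registered stub `stub_higherOrderSlaving` (orders two and three of frozen-vacuum slaving).

A painted summand seen from a base time `t` is `Φ(s, z) = (M/ρ) • ω(a'/ρ, S(s), (z − c(s))/ρ)` for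
the Kerr–Schild master function `ω` of `…StubHigherOrderOmega`, a smooth frame path `S`, a smooth
centre path `c` and a scale `ρ ≥ 1` (`ρ = 1` for the hole under study, `ρ =` the separation for a
far hole, by Kerr–Schild scaling). Its VARIATION FIELDS are `P_m(z) = ∂ₛᵐΦ(t, z)`. When the
parameter point `(a'/ρ, S(t), (x − c(t))/ρ)` lies in the compact parameter box, with
`q_k = ‖S⁽ᵏ⁾(t)‖ + ‖c⁽ᵏ⁾(t)‖` and a constant `C` depending only on the box
(`higherOrder_variation_bounds`):

* frozen jets: `‖DᵏΦ(t, ·)(x)‖ ≤ (|M|/ρ) C` (`k ≤ 3`);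
* first variation: `‖P₁(x)‖, ‖DP₁(x)‖, ‖D²P₁(x)‖ ≤ (|M|/ρ) C q₁`;
* second variation: `‖P₂(x) − (M/ρ) Dom(p)(0, S″, −c″/ρ)‖ ≤ (|M|/ρ) C q₁²`, `‖P₂(x)‖, ‖DP₂(x)‖ ≤ (|M|/ρ) C (q₂ + q₁²)`;
* third variation: `‖P₃(x) − (M/ρ) Dom(p)(0, S‴, −c‴/ρ)‖ ≤ (|M|/ρ) C (q₁³ + 3 q₂ q₁)`,
  `‖P₃(x)‖ ≤ (|M|/ρ) C (q₃ + 3 q₂ q₁ + q₁³)`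

(chain rule to order three along the path `s ↦ (a'/ρ, S s, (z − c s)/ρ)`, `…StubHigherOrderComp`), and
the two-variable field `Φ` is smooth near `(t, x)` (`higherOrder_contDiffOn_summandField`).

No definitions, no named facts, no `sorry`.
-/

set_option linter.dupNamespace false
set_option maxSynthPendingDepth 6
set_option synthInstance.maxHeartbeats 200000

noncomputable section

namespace Summit.FinalStateConjecture.FinalStateConjecture.Theorems.SublinearIsFree.Slaving

open scoped Topology ContDiff
open Filter Set Function Metric Literature.Geometry.Lorentzian

/-! ### The variation bounds -/

set_option maxHeartbeats 6400000 in
/-- **Variation bounds for one painted summand** (see the module docstring). [folklore] -/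
theorem higherOrder_variation_bounds (α₀ γb R' : ℝ) {r₁ : ℝ} (hr₁ : 0 < r₁) :
    ∃ C : ℝ, 0 ≤ C ∧ ∀ (M a' ρ : ℝ) (S : ℝ → E4 →L[ℝ] E4) (cc : ℝ → E4) (t : ℝ) (x : E4),
      1 ≤ ρ → ContDiff ℝ ∞ S → ContDiff ℝ ∞ cc →
      ((ρ⁻¹ * a', S t, ρ⁻¹ • (x - cc t)) : ℝ × (E4 →L[ℝ] E4) × E4) ∈
        {p : ℝ × (E4 →L[ℝ] E4) × E4 | |p.1| ≤ α₀ ∧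
          ((∀ v w, Minkowski.bilin (p.2.1 v) (p.2.1 w) = Minkowski.bilin v w) ∧
            |p.2.1 (E4.basisVector 0) 0| ≤ γb) ∧ ‖p.2.2‖ ≤ R' ∧ r₁ ≤ Kerr.radius p.1 (p.2.1 p.2.2)} →
      let Φ : ℝ → E4 → E4 →L[ℝ] E4 →L[ℝ] ℝ := fun s z ↦ (M / ρ) •
        (fun p : ℝ × (E4 →L[ℝ] E4) × E4 ↦
          (Kerr.bilin 1 p.1 (p.2.1 p.2.2) - Minkowski.bilin).bilinearComp p.2.1 p.2.1)
          (ρ⁻¹ * a', S s, ρ⁻¹ • (z - cc s))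
      let P₁ : E4 → E4 →L[ℝ] E4 →L[ℝ] ℝ := fun z ↦ deriv (fun s ↦ Φ s z) t
      let P₂ : E4 → E4 →L[ℝ] E4 →L[ℝ] ℝ := fun z ↦ iteratedDeriv 2 (fun s ↦ Φ s z) t
      let P₃ : E4 → E4 →L[ℝ] E4 →L[ℝ] ℝ := fun z ↦ iteratedDeriv 3 (fun s ↦ Φ s z) t
      let Dom : (ℝ × (E4 →L[ℝ] E4) × E4) →L[ℝ] (E4 →L[ℝ] E4 →L[ℝ] ℝ) :=
        fderiv ℝ (fun p : ℝ × (E4 →L[ℝ] E4) × E4 ↦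
          (Kerr.bilin 1 p.1 (p.2.1 p.2.2) - Minkowski.bilin).bilinearComp p.2.1 p.2.1)
          (ρ⁻¹ * a', S t, ρ⁻¹ • (x - cc t))
      let q₁ : ℝ := ‖deriv S t‖ + ‖deriv cc t‖
      let q₂ : ℝ := ‖iteratedDeriv 2 S t‖ + ‖iteratedDeriv 2 cc t‖
      let q₃ : ℝ := ‖iteratedDeriv 3 S t‖ + ‖iteratedDeriv 3 cc t‖
      (‖Φ t x‖ ≤ |M| / ρ * C ∧ ‖fderiv ℝ (Φ t) x‖ ≤ |M| / ρ * C ∧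
        ‖fderiv ℝ (fderiv ℝ (Φ t)) x‖ ≤ |M| / ρ * C ∧
        ‖fderiv ℝ (fderiv ℝ (fderiv ℝ (Φ t))) x‖ ≤ |M| / ρ * C) ∧
      (‖P₁ x‖ ≤ |M| / ρ * C * q₁ ∧ ‖fderiv ℝ P₁ x‖ ≤ |M| / ρ * C * q₁ ∧
        ‖fderiv ℝ (fderiv ℝ P₁) x‖ ≤ |M| / ρ * C * q₁) ∧
      (‖P₂ x - (M / ρ) • Dom ((0 : ℝ), iteratedDeriv 2 S t, -(ρ⁻¹ • iteratedDeriv 2 cc t))‖ ≤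
          |M| / ρ * C * q₁ ^ 2 ∧
        ‖P₂ x‖ ≤ |M| / ρ * C * (q₂ + q₁ ^ 2) ∧ ‖fderiv ℝ P₂ x‖ ≤ |M| / ρ * C * (q₂ + q₁ ^ 2)) ∧
      (‖P₃ x - (M / ρ) • Dom ((0 : ℝ), iteratedDeriv 3 S t, -(ρ⁻¹ • iteratedDeriv 3 cc t))‖ ≤
          |M| / ρ * C * (q₁ ^ 3 + 3 * q₂ * q₁) ∧
        ‖P₃ x‖ ≤ |M| / ρ * C * (q₃ + 3 * q₂ * q₁ + q₁ ^ 3)) := by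
  obtain ⟨C, hC0, hC⟩ := higherOrder_exists_omega_bounds α₀ γb R' hr₁
  refine ⟨C, hC0, fun M a' ρ S cc t x hρ hS hcc hbox ↦ ?_⟩
  intro Φ P₁ P₂ P₃ Dom q₁ q₂ q₃
  -- the master function and its domain
  set om : ℝ × (E4 →L[ℝ] E4) × E4 → E4 →L[ℝ] E4 →L[ℝ] ℝ := fun p ↦
    (Kerr.bilin 1 p.1 (p.2.1 p.2.2) - Minkowski.bilin).bilinearComp p.2.1 p.2.1 with homdef
  set Om : Set (ℝ × (E4 →L[ℝ] E4) × E4) := {p | 0 < Kerr.radius p.1 (p.2.1 p.2.2)} with hOmdef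
  have hOmo : IsOpen Om := higherOrder_isOpen_omegaDomain
  have homc : ContDiffOn ℝ ∞ om Om := higherOrder_contDiffOn_omega
  -- sizes
  have hρ0 : 0 < ρ := one_pos.trans_le hρ
  set ρ' : ℝ := ρ⁻¹ with hρ'
  have hρ'0 : 0 < ρ' := inv_pos.2 hρ0
  have hρ'1 : ρ' ≤ 1 := inv_le_one_of_one_le₀ hρ
  have hρ'a : |ρ'| ≤ 1 := by rw [abs_of_pos hρ'0]; exact hρ'1
  have hMρ : ‖M / ρ‖ = |M| / ρ := by rw [Real.norm_eq_abs, abs_div, abs_of_pos hρ0]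
  have hMρ0 : 0 ≤ |M| / ρ := by positivity
  set c₀ : ℝ := ρ⁻¹ * a' with hc₀
  set p : ℝ × (E4 →L[ℝ] E4) × E4 := (c₀, S t, ρ' • (x - cc t)) with hpdef
  have hpbox := hbox
  have hpΩ : p ∈ Om := higherOrder_omegaBox_subset_domain α₀ γb R' hr₁ hbox
  have hC1 : ‖fderiv ℝ om p‖ ≤ C := by
    rw [higherOrder_norm_fderiv_one]; exact hC p hbox 1 (by norm_num)
  have hC2 : ‖fderiv ℝ (fderiv ℝ om) p‖ ≤ C := by
    rw [higherOrder_norm_fderiv_two]; exact hC p hbox 2 (by norm_num)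
  have hC3 : ‖fderiv ℝ (fderiv ℝ (fderiv ℝ om)) p‖ ≤ C := by
    rw [higherOrder_norm_fderiv_three]; exact hC p hbox 3 le_rfl
  -- the affine structure `γ_z(t) = p₀ + L z`
  set L : E4 →L[ℝ] ℝ × (E4 →L[ℝ] E4) × E4 :=
    (0 : E4 →L[ℝ] ℝ).prod ((0 : E4 →L[ℝ] (E4 →L[ℝ] E4)).prod (ρ' • ContinuousLinearMap.id ℝ E4)) with hLdef
  have hLv : ∀ v : E4, L v = ((0 : ℝ), (0 : E4 →L[ℝ] E4), ρ' • v) := fun v ↦ by simp [hLdef]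
  have hLn : ‖L‖ ≤ 1 := by
    refine ContinuousLinearMap.opNorm_le_bound _ zero_le_one fun v ↦ ?_
    rw [hLv, one_mul]
    simp only [Prod.norm_mk, norm_zero, norm_smul, Real.norm_eq_abs]
    refine max_le (norm_nonneg _) (max_le (norm_nonneg _) ?_)
    calc |ρ'| * ‖v‖ ≤ 1 * ‖v‖ := mul_le_mul_of_nonneg_right hρ'a (norm_nonneg _)
      _ = ‖v‖ := one_mul _
  set p₀ : ℝ × (E4 →L[ℝ] E4) × E4 := (c₀, S t, -(ρ' • cc t)) with hp₀def
  have hp₀L' : ∀ z : E4, p₀ + L z = (c₀, S t, ρ' • (z - cc t)) := fun z ↦ by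
    rw [hLv, hp₀def, Prod.mk_add_mk, Prod.mk_add_mk, add_zero, add_zero, smul_sub]
    congr 2
    abel
  have hp₀x : p₀ + L x = p := by rw [hp₀L', hpdef]
  -- the parameter path and its derivatives
  set γ : E4 → ℝ → ℝ × (E4 →L[ℝ] E4) × E4 := fun z s ↦ (c₀, S s, ρ' • (z - cc s)) with hγdef
  have hγt : ∀ z, γ z t = p₀ + L z := fun z ↦ by rw [hp₀L']
  set d₁ : ℝ × (E4 →L[ℝ] E4) × E4 := ((0 : ℝ), deriv S t, -(ρ' • deriv cc t)) with hd₁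
  set d₂ : ℝ × (E4 →L[ℝ] E4) × E4 := ((0 : ℝ), iteratedDeriv 2 S t, -(ρ' • iteratedDeriv 2 cc t)) with hd₂
  set d₃ : ℝ × (E4 →L[ℝ] E4) × E4 := ((0 : ℝ), iteratedDeriv 3 S t, -(ρ' • iteratedDeriv 3 cc t)) with hd₃
  have hγd : ∀ z, ContDiff ℝ ∞ (γ z) ∧ deriv (γ z) t = d₁ ∧ iteratedDeriv 2 (γ z) t = d₂ ∧
      iteratedDeriv 3 (γ z) t = d₃ := fun z ↦ higherOrder_paramPath_derivs c₀ ρ' hS hcc z t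
  have hq₁ : ‖d₁‖ ≤ q₁ := higherOrder_norm_paramDir_le hρ'a _ _
  have hq₂ : ‖d₂‖ ≤ q₂ := higherOrder_norm_paramDir_le hρ'a _ _
  have hq₃ : ‖d₃‖ ≤ q₃ := higherOrder_norm_paramDir_le hρ'a _ _
  have hq₁0 : 0 ≤ q₁ := by positivity
  have hq₂0 : 0 ≤ q₂ := by positivity
  -- the open set of good points and the chain rule there
  set U : Set E4 := {z : E4 | p₀ + L z ∈ Om} with hUdef
  have hUo : IsOpen U := hOmo.preimage (continuous_const.add L.continuous)
  have hxU : x ∈ U := by show p₀ + L x ∈ Om; rw [hp₀x]; exact hpΩ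
  have hΦγ : ∀ z, (fun s ↦ Φ s z) = fun s ↦ (M / ρ) • (om ∘ γ z) s := fun z ↦ rfl
  have hchain : ∀ z ∈ U, deriv (om ∘ γ z) t = fderiv ℝ om (p₀ + L z) d₁ ∧
      iteratedDeriv 2 (om ∘ γ z) t = fderiv ℝ (fderiv ℝ om) (p₀ + L z) d₁ d₁ + fderiv ℝ om (p₀ + L z) d₂ := by
    intro z hz
    obtain ⟨hγc, e1, e2, -⟩ := hγd z
    have hzt : γ z t ∈ Om := by rw [hγt]; exact hz
    obtain ⟨c1, c2, -⟩ := higherOrder_deriv_comp₃ hOmo homc hγc hzt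
    rw [c1, c2, e1, e2, hγt]
    exact ⟨rfl, rfl⟩
  have hsmooth : ∀ z ∈ U, ∀ m : ℕ, ContDiffAt ℝ m (om ∘ γ z) t := fun z hz m ↦ by
    have hzt : γ z t ∈ Om := by rw [hγt]; exact hz
    exact ((homc.contDiffAt (hOmo.mem_nhds hzt)).comp t (hγd z).1.contDiffAt).of_le
      (by exact_mod_cast le_top)
  have hPm : ∀ z ∈ U, ∀ m : ℕ, iteratedDeriv m (fun s ↦ Φ s z) t = (M / ρ) • iteratedDeriv m (om ∘ γ z) t :=
    fun z hz m ↦ by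
    rw [hΦγ z]
    exact iteratedDeriv_const_smul (hsmooth z hz m) (M / ρ)
  -- the variation fields on `U`
  set f₁ : E4 → E4 →L[ℝ] E4 →L[ℝ] ℝ := fun z ↦ fderiv ℝ om (p₀ + L z) d₁ with hf₁
  set f₂ : E4 → E4 →L[ℝ] E4 →L[ℝ] ℝ := fun z ↦ fderiv ℝ (fderiv ℝ om) (p₀ + L z) d₁ d₁ +
    fderiv ℝ om (p₀ + L z) d₂ with hf₂
  have hP₁U : ∀ z ∈ U, P₁ z = (M / ρ) • f₁ z := fun z hz ↦ by
    show deriv (fun s ↦ Φ s z) t = (M / ρ) • f₁ z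
    have h := hPm z hz 1
    rw [iteratedDeriv_one, iteratedDeriv_one] at h
    rw [h, (hchain z hz).1]
  have hP₂U : ∀ z ∈ U, P₂ z = (M / ρ) • f₂ z := fun z hz ↦ by
    show iteratedDeriv 2 (fun s ↦ Φ s z) t = (M / ρ) • f₂ z
    rw [hPm z hz 2, (hchain z hz).2]
  -- derivatives of `f₁`, `f₂` at `x` (affine calculus)
  have hA := higherOrder_fderiv_affine hOmo homc p₀ L hxU d₁ d₁ d₁
  have hA₂ := higherOrder_fderiv_affine hOmo homc p₀ L hxU d₂ d₁ d₁
  have homc₁ : ContDiffOn ℝ ∞ (fderiv ℝ om) Om := homc.fderiv_of_isOpen hOmo (by simp)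
  have homc₂ : ContDiffOn ℝ ∞ (fderiv ℝ (fderiv ℝ om)) Om := homc₁.fderiv_of_isOpen hOmo (by simp)
  have haff : ContDiff ℝ ∞ (fun z : E4 ↦ p₀ + L z) := contDiff_const.add L.contDiff
  have hf₁c : ContDiffOn ℝ ∞ f₁ U :=
    ((homc₁.comp haff.contDiffOn fun z hz ↦ hz).clm_apply contDiffOn_const)
  have hf₂c : ContDiffOn ℝ ∞ f₂ U :=
    (((homc₂.comp haff.contDiffOn fun z hz ↦ hz).clm_apply contDiffOn_const).clm_apply contDiffOn_const).add
      ((homc₁.comp haff.contDiffOn fun z hz ↦ hz).clm_apply contDiffOn_const)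
  have hf₁d : ∀ z ∈ U, DifferentiableAt ℝ f₁ z := fun z hz ↦
    (hf₁c.differentiableOn (by simp)).differentiableAt (hUo.mem_nhds hz)
  have hf₂d : DifferentiableAt ℝ f₂ x := (hf₂c.differentiableOn (by simp)).differentiableAt (hUo.mem_nhds hxU)
  have hf₁dd : DifferentiableAt ℝ (fderiv ℝ f₁) x :=
    ((hf₁c.fderiv_of_isOpen (m := ∞) hUo (by simp)).differentiableOn (by simp)).differentiableAt
      (hUo.mem_nhds hxU)
  -- norms of the derivatives of `f₁`, `f₂` at `x`
  have hn_f₁ : ‖f₁ x‖ ≤ C * q₁ := by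
    show ‖fderiv ℝ om (p₀ + L x) d₁‖ ≤ C * q₁
    rw [hp₀x]
    exact ((fderiv ℝ om p).le_opNorm d₁).trans (mul_le_mul hC1 hq₁ (norm_nonneg _) hC0)
  have hn_Df₁ : ‖fderiv ℝ f₁ x‖ ≤ C * q₁ := by
    refine ContinuousLinearMap.opNorm_le_bound _ (by positivity) fun v ↦ ?_
    rw [hA.1 v, hp₀x]
    calc _ ≤ ‖fderiv ℝ (fderiv ℝ om) p‖ * ‖L v‖ * ‖d₁‖ := (fderiv ℝ (fderiv ℝ om) p).le_opNorm₂ _ _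
      _ ≤ C * (1 * ‖v‖) * q₁ := by
          gcongr
          exact (L.le_opNorm v).trans (mul_le_mul_of_nonneg_right hLn (norm_nonneg _))
      _ = C * q₁ * ‖v‖ := by ring
  have hn_DDf₁ : ‖fderiv ℝ (fderiv ℝ f₁) x‖ ≤ C * q₁ := by
    refine ContinuousLinearMap.opNorm_le_bound _ (by positivity) fun v ↦ ?_
    refine ContinuousLinearMap.opNorm_le_bound _ (by positivity) fun w ↦ ?_
    rw [hA.2.2 v w, hp₀x]
    calc _ ≤ ‖fderiv ℝ (fderiv ℝ (fderiv ℝ om)) p‖ * ‖L v‖ * ‖L w‖ * ‖d₁‖ :=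
          higherOrder_norm_apply₃_le _ _ _ _
      _ ≤ C * (1 * ‖v‖) * (1 * ‖w‖) * q₁ := by
          gcongr
          · exact (L.le_opNorm v).trans (mul_le_mul_of_nonneg_right hLn (norm_nonneg _))
          · exact (L.le_opNorm w).trans (mul_le_mul_of_nonneg_right hLn (norm_nonneg _))
      _ = C * q₁ * ‖v‖ * ‖w‖ := by ring
  have hn_f₂lin : ‖f₂ x - fderiv ℝ om p d₂‖ ≤ C * q₁ ^ 2 := by
    show ‖fderiv ℝ (fderiv ℝ om) (p₀ + L x) d₁ d₁ + fderiv ℝ om (p₀ + L x) d₂ - fderiv ℝ om p d₂‖ ≤ C * q₁ ^ 2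
    rw [hp₀x, add_sub_cancel_right]
    calc _ ≤ ‖fderiv ℝ (fderiv ℝ om) p‖ * ‖d₁‖ * ‖d₁‖ := (fderiv ℝ (fderiv ℝ om) p).le_opNorm₂ _ _
      _ ≤ C * q₁ * q₁ := by gcongr
      _ = C * q₁ ^ 2 := by ring
  have hn_f₂ : ‖f₂ x‖ ≤ C * (q₂ + q₁ ^ 2) := by
    have h1 : ‖fderiv ℝ om p d₂‖ ≤ C * q₂ :=
      ((fderiv ℝ om p).le_opNorm d₂).trans (mul_le_mul hC1 hq₂ (norm_nonneg _) hC0)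
    calc ‖f₂ x‖ = ‖(f₂ x - fderiv ℝ om p d₂) + fderiv ℝ om p d₂‖ := by rw [sub_add_cancel]
      _ ≤ C * q₁ ^ 2 + C * q₂ := (norm_add_le _ _).trans (add_le_add hn_f₂lin h1)
      _ = C * (q₂ + q₁ ^ 2) := by ring
  have hn_Df₂ : ‖fderiv ℝ f₂ x‖ ≤ C * (q₂ + q₁ ^ 2) := by
    have hs : ∀ v, fderiv ℝ f₂ x v = fderiv ℝ (fderiv ℝ (fderiv ℝ om)) (p₀ + L x) (L v) d₁ d₁ +
        fderiv ℝ (fderiv ℝ om) (p₀ + L x) (L v) d₂ := by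
      intro v
      have hd1 : DifferentiableAt ℝ (fun z ↦ fderiv ℝ (fderiv ℝ om) (p₀ + L z) d₁ d₁) x :=
        ((((homc₂.comp haff.contDiffOn fun z hz ↦ hz).clm_apply contDiffOn_const).clm_apply
          contDiffOn_const).differentiableOn (by simp)).differentiableAt (hUo.mem_nhds hxU)
      have hd2 : DifferentiableAt ℝ (fun z ↦ fderiv ℝ om (p₀ + L z) d₂) x :=
        (((homc₁.comp haff.contDiffOn fun z hz ↦ hz).clm_apply contDiffOn_const).differentiableOn
          (by simp)).differentiableAt (hUo.mem_nhds hxU)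
      show fderiv ℝ (fun z ↦ fderiv ℝ (fderiv ℝ om) (p₀ + L z) d₁ d₁ + fderiv ℝ om (p₀ + L z) d₂) x v = _
      rw [(hd1.hasFDerivAt.fun_add hd2.hasFDerivAt).fderiv, _root_.add_apply, hA.2.1 v, hA₂.1 v]
    refine ContinuousLinearMap.opNorm_le_bound _ (by positivity) fun v ↦ ?_
    rw [hs v, hp₀x]
    have hLv1 : ‖L v‖ ≤ ‖v‖ := (L.le_opNorm v).trans (by nlinarith [norm_nonneg v, norm_nonneg L])
    calc _ ≤ ‖fderiv ℝ (fderiv ℝ (fderiv ℝ om)) p (L v) d₁ d₁‖ + ‖fderiv ℝ (fderiv ℝ om) p (L v) d₂‖ :=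
          norm_add_le _ _
      _ ≤ ‖fderiv ℝ (fderiv ℝ (fderiv ℝ om)) p‖ * ‖L v‖ * ‖d₁‖ * ‖d₁‖ +
          ‖fderiv ℝ (fderiv ℝ om) p‖ * ‖L v‖ * ‖d₂‖ :=
          add_le_add (higherOrder_norm_apply₃_le _ _ _ _) ((fderiv ℝ (fderiv ℝ om) p).le_opNorm₂ _ _)
      _ ≤ C * ‖v‖ * q₁ * q₁ + C * ‖v‖ * q₂ := by gcongr
      _ = C * (q₂ + q₁ ^ 2) * ‖v‖ := by ring
  -- (C0) frozen jets
  have hfroz : ∀ k ≤ 3, ‖iteratedFDeriv ℝ k (Φ t) x‖ ≤ |M| / ρ * C := by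
    intro k hk
    have heq : Φ t = fun z ↦ (M / ρ) • om (p₀ + L z) := by
      funext z; show (M / ρ) • om (c₀, S t, ρ' • (z - cc t)) = _; rw [hp₀L']
    have homaff : ContDiffOn ℝ ∞ (fun z ↦ om (p₀ + L z)) U := homc.comp haff.contDiffOn fun z hz ↦ hz
    have hcd : ContDiffAt ℝ k (fun z ↦ om (p₀ + L z)) x :=
      ((homaff.contDiffAt (hUo.mem_nhds hxU)).of_le (by exact_mod_cast le_top))
    rw [heq, show (fun z ↦ (M / ρ) • om (p₀ + L z)) = (M / ρ) • fun z ↦ om (p₀ + L z) from rfl,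
      iteratedFDeriv_const_smul_apply hcd, norm_smul, hMρ]
    refine mul_le_mul_of_nonneg_left ?_ hMρ0
    refine (higherOrder_norm_iteratedFDeriv_comp_affine_le hOmo homc p₀ L hxU k).trans ?_
    rw [hp₀x]
    calc ‖iteratedFDeriv ℝ k om p‖ * ‖L‖ ^ k ≤ C * 1 ^ k := by
          gcongr
          · exact hC p hbox k hk
      _ = C := by rw [one_pow, mul_one]
  refine ⟨⟨?_, ?_, ?_, ?_⟩, ⟨?_, ?_, ?_⟩, ⟨?_, ?_, ?_⟩, ⟨?_, ?_⟩⟩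
  · have h := hfroz 0 (by norm_num); rwa [norm_iteratedFDeriv_zero] at h
  · have h := hfroz 1 (by norm_num); rwa [← higherOrder_norm_fderiv_one] at h
  · have h := hfroz 2 (by norm_num); rwa [← higherOrder_norm_fderiv_two] at h
  · have h := hfroz 3 le_rfl; rwa [← higherOrder_norm_fderiv_three] at h
  -- (C1)
  · rw [hP₁U x hxU, norm_smul, hMρ, mul_assoc]
    exact mul_le_mul_of_nonneg_left hn_f₁ hMρ0
  · rw [higherOrder_fderiv_const_smul_of_eqOn hUo hxU (M / ρ) (hf₁d x hxU) hP₁U, norm_smul, hMρ, mul_assoc]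
    exact mul_le_mul_of_nonneg_left hn_Df₁ hMρ0
  · have hD : ∀ z ∈ U, fderiv ℝ P₁ z = (M / ρ) • fderiv ℝ f₁ z := fun z hz ↦
      higherOrder_fderiv_const_smul_of_eqOn hUo hz (M / ρ) (hf₁d z hz) hP₁U
    rw [higherOrder_fderiv_const_smul_of_eqOn hUo hxU (M / ρ) hf₁dd hD, norm_smul, hMρ, mul_assoc]
    exact mul_le_mul_of_nonneg_left hn_DDf₁ hMρ0
  -- (C2)
  · show ‖P₂ x - (M / ρ) • fderiv ℝ om p d₂‖ ≤ _
    rw [hP₂U x hxU, ← smul_sub, norm_smul, hMρ, mul_assoc]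
    exact mul_le_mul_of_nonneg_left hn_f₂lin hMρ0
  · rw [hP₂U x hxU, norm_smul, hMρ, mul_assoc]
    exact mul_le_mul_of_nonneg_left hn_f₂ hMρ0
  · rw [higherOrder_fderiv_const_smul_of_eqOn hUo hxU (M / ρ) hf₂d hP₂U, norm_smul, hMρ, mul_assoc]
    exact mul_le_mul_of_nonneg_left hn_Df₂ hMρ0
  -- (C3)
  · show ‖P₃ x - (M / ρ) • fderiv ℝ om p d₃‖ ≤ _
    have h3 : P₃ x = (M / ρ) • iteratedDeriv 3 (om ∘ γ x) t := hPm x hxU 3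
    obtain ⟨hγc, e1, e2, e3⟩ := hγd x
    have hxt : γ x t ∈ Om := by rw [hγt]; exact hxU
    have hb := higherOrder_norm_deriv_comp₃_le (C := C) hOmo homc hγc hxt
      (by rw [hγt, hp₀x, ← higherOrder_norm_fderiv_one]; exact hC1)
      (by rw [hγt, hp₀x, ← higherOrder_norm_fderiv_two]; exact hC2)
      (by rw [hγt, hp₀x, ← higherOrder_norm_fderiv_three]; exact hC3)
    obtain ⟨-, -, b3, -, -⟩ := hb
    rw [e1, e2, e3, hγt, hp₀x] at b3
    rw [h3, ← smul_sub, norm_smul, hMρ, mul_assoc]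
    refine mul_le_mul_of_nonneg_left (b3.trans ?_) hMρ0
    gcongr
  · have h3 : P₃ x = (M / ρ) • iteratedDeriv 3 (om ∘ γ x) t := hPm x hxU 3
    obtain ⟨hγc, e1, e2, e3⟩ := hγd x
    have hxt : γ x t ∈ Om := by rw [hγt]; exact hxU
    have hb := higherOrder_norm_deriv_comp₃_le (C := C) hOmo homc hγc hxt
      (by rw [hγt, hp₀x, ← higherOrder_norm_fderiv_one]; exact hC1)
      (by rw [hγt, hp₀x, ← higherOrder_norm_fderiv_two]; exact hC2)
      (by rw [hγt, hp₀x, ← higherOrder_norm_fderiv_three]; exact hC3)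
    obtain ⟨-, -, -, -, b3⟩ := hb
    rw [e1, e2, e3] at b3
    rw [h3, norm_smul, hMρ, mul_assoc]
    refine mul_le_mul_of_nonneg_left (b3.trans ?_) hMρ0
    gcongr

/-- **Registered one-line carrier form** (`higherOrder_variationBounds_EF`) of
`higherOrder_variation_bounds`. [folklore] -/
theorem higherOrder_variationBounds_EF : open Literature.Geometry.Lorentzian in ∀ (α₀ γb R' : ℝ) {r₁ : ℝ}, 0 < r₁ → ∃ C : ℝ, 0 ≤ C ∧ ∀ (M a' ρ : ℝ) (S : ℝ → E4 →L[ℝ] E4) (cc : ℝ → E4) (t : ℝ) (x : E4), 1 ≤ ρ → ContDiff ℝ ((⊤ : ℕ∞) : WithTop ℕ∞) S → ContDiff ℝ ((⊤ : ℕ∞) : WithTop ℕ∞) cc → ((ρ⁻¹ * a', S t, ρ⁻¹ • (x - cc t)) : ℝ × (E4 →L[ℝ] E4) × E4) ∈ {p : ℝ × (E4 →L[ℝ] E4) × E4 | |p.1| ≤ α₀ ∧ ((∀ v w, Minkowski.bilin (p.2.1 v) (p.2.1 w) = Minkowski.bilin v w) ∧ |p.2.1 (E4.basisVector 0) 0|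 ≤ γb) ∧ ‖p.2.2‖ ≤ R' ∧ r₁ ≤ Kerr.radius p.1 (p.2.1 p.2.2)} → let Φ : ℝ → E4 → E4 →L[ℝ] E4 →L[ℝ] ℝ := fun s z ↦ (M / ρ) • (fun p : ℝ × (E4 →L[ℝ] E4) × E4 ↦ (Kerr.bilin 1 p.1 (p.2.1 p.2.2) - Minkowski.bilin).bilinearComp p.2.1 p.2.1) (ρ⁻¹ * a', S s, ρ⁻¹ • (z - cc s)); let P₁ : E4 → E4 →L[ℝ] E4 →L[ℝ] ℝ := fun z ↦ deriv (fun s ↦ Φ s z) t; let P₂ : E4 → E4 →L[ℝ] E4 →L[ℝ] ℝ := fun z ↦ iteratedDeriv 2 (fun s ↦ Φ s z) t; let P₃ : E4 → E4 →L[ℝ] E4 →L[ℝ] ℝ := fun z ↦ iteratedDeriv 3 (fun s ↦ Φ s z) t; let Dom : (ℝ × (E4 →L[ℝ] E4) × E4) →L[ℝ] (E4 →L[ℝ] E4 →L[ℝ] ℝ) := fderiv ℝ (fun p : ℝ × (E4 →L[ℝ] E4) × E4 ↦ (Kerr.bilin 1 p.1 (p.2.1 p.2.2) - Minkowski.bilin).bilinearComp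 p.2.1 p.2.1) (ρ⁻¹ * a', S t, ρ⁻¹ • (x - cc t)); let q₁ : ℝ := ‖deriv S t‖ + ‖deriv cc t‖; let q₂ : ℝ := ‖iteratedDeriv 2 S t‖ + ‖iteratedDeriv 2 cc t‖; let q₃ : ℝ := ‖iteratedDeriv 3 S t‖ + ‖iteratedDeriv 3 cc t‖; (‖Φ t x‖ ≤ |M| / ρ * C ∧ ‖fderiv ℝ (Φ t) x‖ ≤ |M| / ρ * C ∧ ‖fderiv ℝ (fderiv ℝ (Φ t)) x‖ ≤ |M| / ρ * C ∧ ‖fderiv ℝ (fderiv ℝ (fderiv ℝ (Φ t))) x‖ ≤ |M| / ρ * C) ∧ (‖P₁ x‖ ≤ |M| / ρ * C * q₁ ∧ ‖fderiv ℝ P₁ x‖ ≤ |M| / ρ * C * q₁ ∧ ‖fderiv ℝ (fderiv ℝ P₁) x‖ ≤ |M| / ρ * C * q₁) ∧ (‖P₂ x - (M / ρ) • Dom ((0 : ℝ), iteratedDeriv 2 S t, -(ρ⁻¹ • iteratedDeriv 2 cc t))‖ ≤ |M| / ρ * C * q₁ ^ 2 ∧ ‖P₂ x‖ ≤ |M|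 / ρ * C * (q₂ + q₁ ^ 2) ∧ ‖fderiv ℝ P₂ x‖ ≤ |M| / ρ * C * (q₂ + q₁ ^ 2)) ∧ (‖P₃ x - (M / ρ) • Dom ((0 : ℝ), iteratedDeriv 3 S t, -(ρ⁻¹ • iteratedDeriv 3 cc t))‖ ≤ |M| / ρ * C * (q₁ ^ 3 + 3 * q₂ * q₁) ∧ ‖P₃ x‖ ≤ |M| / ρ * C * (q₃ + 3 * q₂ * q₁ + q₁ ^ 3)) :=
  fun α₀ γb R' _ hr₁ ↦ higherOrder_variation_bounds α₀ γb R' hr₁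

end Summit.FinalStateConjecture.FinalStateConjecture.Theorems.SublinearIsFree.Slaving

end
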